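import Mathlib.RepresentationTheory.Continuous.Basic
import Mathlib.Topology.Algebra.ContinuousMonoidHom
import Mathlib.Topology.Algebra.Module.LinearPMap
import Mathlib.LinearAlgebra.LinearPMap
import Mathlib.Analysis.Calculus.Deriv.Basic
import Mathlib.Analysis.Calculus.Deriv.Slope
import Mathlib.Analysis.RCLike.Basic
import Mathlib.Topology.Instances.NNReal.Lemmas
import HarnessLib

-- provenance: harness21/H21/H21/Prelude/UnbddOp/StrongContRepresentation.lean @ 04f08e6 (interim HEAD d8f2665); M5 mechanical rewrite
/-!
# Strongly continuous representations, C₀-semigroups and their generators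
(trunk G07 UnbddOp, item C3 `StrongContRepresentation`)

A *strongly continuous representation* of a topological monoid `G` on a topological `𝕜`-module `V`
is a monoid homomorphism `π : G →* (V →L[𝕜] V)` such that every orbit map `g ↦ π g v` is
continuous. Specialising `G` to `Multiplicative ℝ≥0` (resp. `Multiplicative ℝ`) gives
*C₀-semigroups* `(T(t))_{t ≥ 0}` (resp. strongly continuous one-parameter groups `(U(t))_{t ∈ ℝ}`),
and we define the (infinitesimal) *generator* `A x = lim_{t ↓ 0} t⁻¹ (T(t) x - x)` as a partially
defined linear map `E →ₗ.[𝕜] E`, with the convention `T(t) = exp (t A)`.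

Sources: K.-J. Engel, R. Nagel, *One-Parameter Semigroups for Linear Evolution Equations* (Springer
GTM 194, 2000), Ch. I Def. 5.1 (C₀-semigroup), Ch. II §1 (Def. 1.2 generator, Lemma 1.3, Thm. 1.4);
E. Hille, R. S. Phillips, *Functional Analysis and Semi-Groups* (AMS Coll. Publ. 31, 1957), Ch. X–XI.

## Mathlib

Mathlib (pinned) has `ContRepresentation 𝕜 G V` (a bare monoid hom `G →* V →L[𝕜] V`, no topology
on `G`, with `FunLike`, `restrict`, `toRepresentation`), `ContinuousMonoidHom` (`G →ₜ* G'`),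
`LinearPMap` with `Submodule.toLinearPMap` / `Submodule.toLinearPMap_graph_eq` and
`LinearPMap.IsClosed`. It has no strongly continuous representations, no C₀-semigroups and no
generators; everything below is a thin layer over these anchors.

## Design choices

* `StrongContRepresentation 𝕜 G V extends ContRepresentation 𝕜 G V` in exactly Mathlib's context
  (topological additive group `V` with a `𝕜`-module structure, *not* normed), adding the field
  `strongly_continuous` (name chosen so as not to shadow `_root_.continuous_apply`).
* `C0Semigroup 𝕜 E` and `OneParameterGroup 𝕜 E` are `abbrev`s for `G = Multiplicative ℝ≥0`,
  `Multiplicative ℝ`; the semigroup/generator API is stated for a topological vector space `E` over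
  an `RCLike` field (so that e.g. `C0Semigroup ℂ 𝓢(E, F)` typechecks); operator-norm notions
  (`IsContraction`, derivative, density and closedness of the generator) live in a normed section.
* The generator is defined through its **graph** `generatorGraph T : Submodule 𝕜 (E × E)` (whose
  closure properties have honest short proofs) and `Submodule.toLinearPMap`; no proof obligation is
  hidden inside a definition. `generator_graph` identifies the graph back (Hausdorff `E`).
* Downstream note: on a term `U` of a structure *extending* `OneParameterGroup` (e.g. `UnitaryRep`)
  write `OneParameterGroup.generator U.toStrongContRepresentation` explicitly.
-/

noncomputable section

open Filter Topology NNReal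

namespace Literature.Analysis.UnboundedOperators

/-! ### Strongly continuous representations -/

/-- A *strongly continuous representation* of a topological monoid `G` on a topological
`𝕜`-module `V`: a monoid homomorphism `G →* (V →L[𝕜] V)` (Mathlib's `ContRepresentation`) all of
whose orbit maps `g ↦ π g v` are continuous (continuity for the strong operator topology).
Engel–Nagel (2000), Ch. I Def. 5.1; for groups, Folland, *A Course in Abstract Harmonic Analysis*
(1995), §3.1. [cite: EngelNagel2000] -/
structure StrongContRepresentation (𝕜 G V : Type*) [Ring 𝕜] [Monoid G] [TopologicalSpace G]
    [AddCommGroup V] [TopologicalSpace V] [IsTopologicalAddGroup V] [Module 𝕜 V]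
    extends ContRepresentation 𝕜 G V where
  /-- Every orbit map `g ↦ π g v` is continuous. -/
  strongly_continuous : ∀ v : V, Continuous fun g : G => toMonoidHom g v

namespace StrongContRepresentation

variable {𝕜 G G' V : Type*} [Ring 𝕜] [Monoid G] [TopologicalSpace G] [Monoid G']
  [TopologicalSpace G'] [AddCommGroup V] [TopologicalSpace V] [IsTopologicalAddGroup V] [Module 𝕜 V]

/-- A strongly continuous representation is a function `G → (V →L[𝕜] V)`
(Engel–Nagel (2000), Ch. I Def. 5.1). [cite: EngelNagel2000] -/
instance instFunLike : FunLike (StrongContRepresentation 𝕜 G V) G (V →L[𝕜] V) where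
  coe π := π.toMonoidHom
  coe_injective π₁ π₂ h := by
    obtain ⟨π₁, _⟩ := π₁
    obtain ⟨π₂, _⟩ := π₂
    congr
    exact DFunLike.coe_injective h

/-- A strongly continuous representation is a monoid homomorphism `G →* (V →L[𝕜] V)`
(Engel–Nagel (2000), Ch. I Def. 5.1, functional equation (FE)). [cite: EngelNagel2000] -/
instance instMonoidHomClass : MonoidHomClass (StrongContRepresentation 𝕜 G V) G (V →L[𝕜] V) where
  map_one π := π.toMonoidHom.map_one
  map_mul π := π.toMonoidHom.map_mul

/-- Two strongly continuous representations agreeing pointwise are equal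
(Engel–Nagel (2000), Ch. I Def. 5.1). [cite: EngelNagel2000] -/
@[ext]
theorem ext {π₁ π₂ : StrongContRepresentation 𝕜 G V} (h : ∀ g, π₁ g = π₂ g) : π₁ = π₂ :=
  DFunLike.ext _ _ h

/-- The coercion of the underlying `ContRepresentation` agrees with the coercion of `π`
(Engel–Nagel (2000), Ch. I Def. 5.1). [cite: EngelNagel2000] -/
@[simp]
theorem coe_toContRepresentation (π : StrongContRepresentation 𝕜 G V) :
    ⇑π.toContRepresentation = ⇑π := rfl

/-- The underlying monoid homomorphism agrees with the coercion of `π`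
(Engel–Nagel (2000), Ch. I Def. 5.1). [cite: EngelNagel2000] -/
@[simp]
theorem toMonoidHom_apply (π : StrongContRepresentation 𝕜 G V) (g : G) :
    π.toMonoidHom g = π g := rfl

/-- The constructor applied to the coercion (Engel–Nagel (2000), Ch. I Def. 5.1). [cite: EngelNagel2000] -/
@[simp]
theorem coe_mk (π : ContRepresentation 𝕜 G V) (h) :
    ⇑(StrongContRepresentation.mk π h) = ⇑π := rfl

/-- Strong continuity: every orbit map `g ↦ π g v` is continuous
(Engel–Nagel (2000), Ch. I Def. 5.1 / Prop. 5.3). [cite: EngelNagel2000] -/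
@[continuity, fun_prop]
theorem continuous_apply_apply (π : StrongContRepresentation 𝕜 G V) (v : V) :
    Continuous fun g : G => π g v :=
  π.strongly_continuous v

/-- Restriction of a strongly continuous representation along a continuous monoid homomorphism
`φ : G' →ₜ* G` (Mathlib: `ContRepresentation.restrict`; Engel–Nagel (2000), Ch. I §5.b,
rescaled semigroups). [cite: EngelNagel2000] -/
def restrict (π : StrongContRepresentation 𝕜 G V) (φ : G' →ₜ* G) :
    StrongContRepresentation 𝕜 G' V where
  toContRepresentation := π.toContRepresentation.restrict φ.toMonoidHom
  strongly_continuous v := (π.strongly_continuous v).comp φ.continuous_toFun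

/-- `π.restrict φ g' = π (φ g')` (Mathlib: `ContRepresentation.restrict_apply`). [folklore] -/
@[simp]
theorem restrict_apply (π : StrongContRepresentation 𝕜 G V) (φ : G' →ₜ* G) (g' : G') :
    π.restrict φ g' = π (φ g') := rfl

end StrongContRepresentation

/-! ### C₀-semigroups and one-parameter groups -/

section Semigroup

variable (𝕜 E : Type*) [RCLike 𝕜] [AddCommGroup E] [Module 𝕜 E] [TopologicalSpace E]
  [IsTopologicalAddGroup E]

/-- A *C₀-semigroup* (strongly continuous one-parameter semigroup) `(T(t))_{t ≥ 0}` of continuous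
linear operators on `E`: `T(0) = 1`, `T(s + t) = T(s) T(t)` and `t ↦ T(t) x` continuous for every
`x`. Encoded as a strongly continuous representation of `Multiplicative ℝ≥0`.
Engel–Nagel (2000), Ch. I Def. 5.1; Hille–Phillips (1957), Def. 10.6.4. [cite: EngelNagel2000] -/
abbrev C0Semigroup := StrongContRepresentation 𝕜 (Multiplicative ℝ≥0) E

/-- A *strongly continuous one-parameter group* `(U(t))_{t ∈ ℝ}` of continuous linear operators
on `E` (a C₀-group). Encoded as a strongly continuous representation of `Multiplicative ℝ`.
Engel–Nagel (2000), Ch. I Def. 5.1 and §II.3.11. [cite: EngelNagel2000] -/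
abbrev OneParameterGroup := StrongContRepresentation 𝕜 (Multiplicative ℝ) E

/-- The coercion `ℝ≥0 → ℝ`, `t ↦ ↑t`, transported to `Multiplicative` and bundled as a continuous
monoid homomorphism `Multiplicative ℝ≥0 →ₜ* Multiplicative ℝ` (used to restrict a one-parameter
group to its forward semigroup; Engel–Nagel (2000), §I.5, generalities on groups vs. semigroups).
The name is fixed by the trunk outline; Mathlib has no bundled version of this map. [cite: EngelNagel2000] -/
def toRealMulHom : Multiplicative ℝ≥0 →ₜ* Multiplicative ℝ where
  toFun t := Multiplicative.ofAdd ((Multiplicative.toAdd t : ℝ≥0) : ℝ)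
  map_one' := by simp
  map_mul' s t := by simp [← ofAdd_add]
  continuous_toFun := continuous_ofAdd.comp (NNReal.continuous_coe.comp continuous_toAdd)

/-- `toRealMulHom (ofAdd t) = ofAdd ↑t`: the map is the coercion `ℝ≥0 → ℝ` transported to
`Multiplicative` (Engel–Nagel (2000), §I.5). [cite: EngelNagel2000] -/
@[simp]
theorem toRealMulHom_apply (t : ℝ≥0) :
    toRealMulHom (Multiplicative.ofAdd t) = Multiplicative.ofAdd (t : ℝ) := rfl

variable {𝕜 E}

namespace C0Semigroup

/-- The operator `T(t)` of a C₀-semigroup at time `t : ℝ≥0`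
(Engel–Nagel (2000), Ch. I Def. 5.1). [cite: EngelNagel2000] -/
def app (T : C0Semigroup 𝕜 E) (t : ℝ≥0) : E →L[𝕜] E := T (Multiplicative.ofAdd t)

/-- `T(0) = 1` (Engel–Nagel (2000), Ch. I Def. 5.1 (FE)). [cite: EngelNagel2000] -/
@[simp]
theorem app_zero (T : C0Semigroup 𝕜 E) : T.app 0 = 1 := by
  simp [app]

/-- The semigroup law `T(s + t) = T(s) T(t)` (Engel–Nagel (2000), Ch. I Def. 5.1 (FE)). [cite: EngelNagel2000] -/
theorem app_add (T : C0Semigroup 𝕜 E) (s t : ℝ≥0) : T.app (s + t) = T.app s * T.app t := by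
  simp [app, ofAdd_add]

/-- The operators of a C₀-semigroup commute: `T(s) T(t) = T(t) T(s)`
(Engel–Nagel (2000), Ch. I Def. 5.1). [cite: EngelNagel2000] -/
theorem app_comm (T : C0Semigroup 𝕜 E) (s t : ℝ≥0) :
    T.app s * T.app t = T.app t * T.app s := by
  rw [← app_add, ← app_add, add_comm]

/-- Strong continuity: `t ↦ T(t) x` is continuous (Engel–Nagel (2000), Ch. I Def. 5.1). [cite: EngelNagel2000] -/
@[continuity, fun_prop]
theorem continuous_app (T : C0Semigroup 𝕜 E) (x : E) : Continuous fun t : ℝ≥0 => T.app t x :=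
  (T.strongly_continuous x).comp continuous_ofAdd

end C0Semigroup

namespace OneParameterGroup

/-- The operator `U(t)` of a one-parameter group at time `t : ℝ`
(Engel–Nagel (2000), Ch. I Def. 5.1). [cite: EngelNagel2000] -/
def app (U : OneParameterGroup 𝕜 E) (t : ℝ) : E →L[𝕜] E := U (Multiplicative.ofAdd t)

/-- `U(0) = 1` (Engel–Nagel (2000), Ch. I Def. 5.1 (FE)). [cite: EngelNagel2000] -/
@[simp]
theorem app_zero (U : OneParameterGroup 𝕜 E) : U.app 0 = 1 := by
  simp [app]

/-- The group law `U(s + t) = U(s) U(t)` (Engel–Nagel (2000), Ch. I Def. 5.1 (FE)). [cite: EngelNagel2000] -/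
theorem app_add (U : OneParameterGroup 𝕜 E) (s t : ℝ) : U.app (s + t) = U.app s * U.app t := by
  simp [app, ofAdd_add]

/-- `U(-t) U(t) = 1` (Engel–Nagel (2000), §II.3.11). [cite: EngelNagel2000] -/
@[simp]
theorem app_neg_mul_app (U : OneParameterGroup 𝕜 E) (t : ℝ) : U.app (-t) * U.app t = 1 := by
  rw [← app_add, neg_add_cancel, app_zero]

/-- `U(t) U(-t) = 1` (Engel–Nagel (2000), §II.3.11). [cite: EngelNagel2000] -/
@[simp]
theorem app_mul_app_neg (U : OneParameterGroup 𝕜 E) (t : ℝ) : U.app t * U.app (-t) = 1 := by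
  rw [← app_add, add_neg_cancel, app_zero]

/-- `U(-t)` is a two-sided inverse of `U(t)`: `U(-t) (U(t) x) = x`
(Engel–Nagel (2000), §II.3.11). [cite: EngelNagel2000] -/
@[simp]
theorem app_neg_apply_app (U : OneParameterGroup 𝕜 E) (t : ℝ) (x : E) :
    U.app (-t) (U.app t x) = x := by
  rw [← mul_apply_eq_comp, app_neg_mul_app, one_apply_eq_self]

/-- The operator `U(t)` of a one-parameter group as a unit of `E →L[𝕜] E`, with inverse `U(-t)`
(Engel–Nagel (2000), §II.3.11). [cite: EngelNagel2000] -/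
@[simps]
def appUnit (U : OneParameterGroup 𝕜 E) (t : ℝ) : (E →L[𝕜] E)ˣ where
  val := U.app t
  inv := U.app (-t)
  val_inv := U.app_mul_app_neg t
  inv_val := U.app_neg_mul_app t

/-- `U(-t) = U(t)⁻¹` as units of `E →L[𝕜] E` (Engel–Nagel (2000), §II.3.11). [cite: EngelNagel2000] -/
theorem app_neg (U : OneParameterGroup 𝕜 E) (t : ℝ) : U.app (-t) = ↑(U.appUnit t)⁻¹ := rfl

/-- `appUnit` is additive-to-multiplicative: `U.appUnit (s + t) = U.appUnit s * U.appUnit t`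
(Engel–Nagel (2000), Ch. I Def. 5.1 (FE)). [cite: EngelNagel2000] -/
theorem appUnit_add (U : OneParameterGroup 𝕜 E) (s t : ℝ) :
    U.appUnit (s + t) = U.appUnit s * U.appUnit t :=
  Units.ext (U.app_add s t)

/-- Strong continuity: `t ↦ U(t) x` is continuous (Engel–Nagel (2000), Ch. I Def. 5.1). [cite: EngelNagel2000] -/
@[continuity, fun_prop]
theorem continuous_app (U : OneParameterGroup 𝕜 E) (x : E) : Continuous fun t : ℝ => U.app t x :=
  (U.strongly_continuous x).comp continuous_ofAdd

/-- The forward C₀-semigroup `(U(t))_{t ≥ 0}` of a one-parameter group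
(Engel–Nagel (2000), §II.3.11, generator of a group). [cite: EngelNagel2000] -/
def toC0Semigroup (U : OneParameterGroup 𝕜 E) : C0Semigroup 𝕜 E := U.restrict toRealMulHom

/-- `U.toC0Semigroup.app t = U.app t` for `t ≥ 0` (Engel–Nagel (2000), §II.3.11). [cite: EngelNagel2000] -/
@[simp]
theorem toC0Semigroup_app (U : OneParameterGroup 𝕜 E) (t : ℝ≥0) :
    U.toC0Semigroup.app t = U.app (t : ℝ) := rfl

end OneParameterGroup

/-! ### The generator -/

variable [ContinuousSMul 𝕜 E]

namespace C0Semigroup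

/-- The graph of the generator of a C₀-semigroup: the pairs `(x, y)` with
`t⁻¹ (T(t) x - x) → y` as `t ↓ 0` (Engel–Nagel (2000), Ch. II Def. 1.2). It is a submodule of
`E × E`. [cite: EngelNagel2000] -/
def generatorGraph (T : C0Semigroup 𝕜 E) : Submodule 𝕜 (E × E) where
  carrier := {p | Tendsto (fun t : ℝ => ((t⁻¹ : ℝ) : 𝕜) • (T.app t.toNNReal p.1 - p.1))
    (𝓝[>] 0) (𝓝 p.2)}
  zero_mem' := by simpa using tendsto_const_nhds
  add_mem' {p q} hp hq := by
    refine (hp.add hq).congr fun t => ?_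
    simp only [Prod.fst_add, map_add, ← smul_add]
    congr 1
    abel
  smul_mem' c {p} hp := by
    refine (hp.const_smul c).congr fun t => ?_
    simp only [Prod.smul_fst, map_smul, smul_sub, smul_comm c]

/-- Membership in the generator graph is convergence of the difference quotient
(Engel–Nagel (2000), Ch. II Def. 1.2). [cite: EngelNagel2000] -/
theorem mem_generatorGraph_iff (T : C0Semigroup 𝕜 E) (p : E × E) :
    p ∈ T.generatorGraph ↔ Tendsto (fun t : ℝ => ((t⁻¹ : ℝ) : 𝕜) • (T.app t.toNNReal p.1 - p.1))
      (𝓝[>] 0) (𝓝 p.2) :=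
  Iff.rfl

/-- The generator graph is functional: `(0, y) ∈ generatorGraph T → y = 0` (in a Hausdorff space,
by uniqueness of limits; Engel–Nagel (2000), Ch. II Def. 1.2). [cite: EngelNagel2000] -/
theorem generatorGraph_fst_eq_zero [T2Space E] (T : C0Semigroup 𝕜 E) :
    ∀ p ∈ T.generatorGraph, p.1 = 0 → p.2 = 0 := by
  rintro ⟨x, y⟩ hp rfl
  have h0 : Tendsto (fun t : ℝ => ((t⁻¹ : ℝ) : 𝕜) • (T.app t.toNNReal (0 : E) - 0))
      (𝓝[>] 0) (𝓝 0) := by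
    simp
  exact tendsto_nhds_unique hp h0

/-- The (infinitesimal) *generator* `A` of a C₀-semigroup, `A x = lim_{t ↓ 0} t⁻¹ (T(t) x - x)` on
the domain of those `x` for which the limit exists, as a partially defined linear map; convention
`T(t) = exp (t A)`. Built from `generatorGraph` via `Submodule.toLinearPMap`
(Engel–Nagel (2000), Ch. II Def. 1.2; Hille–Phillips (1957), Def. 10.3.4).

Junk value: `Submodule.toLinearPMap` returns the *zero* map on the projected domain when the graph
is not functional, which for `generatorGraph T` can only happen when `E` is not Hausdorff (limits
not unique). All lemmas relating `generator` back to the difference quotient (`generator_graph`,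
`generator_apply_eq_of_tendsto`, `tendsto_generator`, `generator_app_comm`) therefore assume
`[T2Space E]`, which is exactly where this matters. [cite: EngelNagel2000] -/
def generator (T : C0Semigroup 𝕜 E) : E →ₗ.[𝕜] E := T.generatorGraph.toLinearPMap

/-- The graph of the generator is `generatorGraph T` (Mathlib: `Submodule.toLinearPMap_graph_eq`;
Engel–Nagel (2000), Ch. II Def. 1.2). [cite: EngelNagel2000] -/
@[simp]
theorem generator_graph [T2Space E] (T : C0Semigroup 𝕜 E) :
    T.generator.graph = T.generatorGraph :=
  Submodule.toLinearPMap_graph_eq _ T.generatorGraph_fst_eq_zero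

/-- `x ∈ D(A)` iff the difference quotient `t⁻¹ (T(t) x - x)` converges as `t ↓ 0`
(Engel–Nagel (2000), Ch. II Def. 1.2). [cite: EngelNagel2000] -/
theorem mem_generator_domain_iff (T : C0Semigroup 𝕜 E) (x : E) :
    x ∈ T.generator.domain ↔ ∃ y : E, Tendsto
      (fun t : ℝ => ((t⁻¹ : ℝ) : 𝕜) • (T.app t.toNNReal x - x)) (𝓝[>] 0) (𝓝 y) := by
  simp [generator, Submodule.toLinearPMap_domain, Submodule.mem_map, mem_generatorGraph_iff]

/-- If `t⁻¹ (T(t) x - x) → y` as `t ↓ 0` then `A x = y`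
(Engel–Nagel (2000), Ch. II Def. 1.2). [cite: EngelNagel2000] -/
theorem generator_apply_eq_of_tendsto [T2Space E] (T : C0Semigroup 𝕜 E)
    (x : T.generator.domain) {y : E}
    (h : Tendsto (fun t : ℝ => ((t⁻¹ : ℝ) : 𝕜) • (T.app t.toNNReal (x : E) - x))
      (𝓝[>] 0) (𝓝 y)) :
    T.generator x = y := by
  have hy : ((x : E), y) ∈ T.generator.graph := by
    rw [generator_graph]; exact h
  exact T.generator.mem_graph_snd_inj (T.generator.mem_graph x) hy rfl

/-- The difference quotient of `x ∈ D(A)` converges to `A x`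
(Engel–Nagel (2000), Ch. II Def. 1.2). [cite: EngelNagel2000] -/
theorem tendsto_generator [T2Space E] (T : C0Semigroup 𝕜 E) (x : T.generator.domain) :
    Tendsto (fun t : ℝ => ((t⁻¹ : ℝ) : 𝕜) • (T.app t.toNNReal (x : E) - x))
      (𝓝[>] 0) (𝓝 (T.generator x)) := by
  have := T.generator.mem_graph x
  rw [generator_graph] at this
  exact this

/-- The domain of the generator is invariant under the semigroup: `x ∈ D(A) → T(t) x ∈ D(A)`
(Engel–Nagel (2000), Ch. II Lemma 1.3 (ii)). [cite: EngelNagel2000] -/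
theorem app_mem_generator_domain (T : C0Semigroup 𝕜 E) {x : E} (hx : x ∈ T.generator.domain)
    (t : ℝ≥0) : T.app t x ∈ T.generator.domain := by
  rw [mem_generator_domain_iff] at hx ⊢
  obtain ⟨y, hy⟩ := hx
  refine ⟨T.app t y, (((T.app t).continuous.tendsto y).comp hy).congr fun s => ?_⟩
  simp only [Function.comp_apply, map_smul, map_sub, ← mul_apply_eq_comp, app_comm]

/-- The generator commutes with the semigroup on its domain: `A T(t) x = T(t) A x` for `x ∈ D(A)`
(Engel–Nagel (2000), Ch. II Lemma 1.3 (ii)). [cite: EngelNagel2000] -/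
theorem generator_app_comm [T2Space E] (T : C0Semigroup 𝕜 E) (x : T.generator.domain)
    (t : ℝ≥0) :
    T.generator ⟨T.app t x, T.app_mem_generator_domain x.2 t⟩ = T.app t (T.generator x) := by
  refine T.generator_apply_eq_of_tendsto _ ?_
  refine (((T.app t).continuous.tendsto _).comp (T.tendsto_generator x)).congr fun s => ?_
  simp only [Function.comp_apply, map_smul, map_sub, ← mul_apply_eq_comp, app_comm]

end C0Semigroup

namespace OneParameterGroup

/-- The generator `A` of a strongly continuous one-parameter group, i.e. the generator of its
forward semigroup `(U(t))_{t ≥ 0}`; convention `U(t) = exp (t A)`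
(Engel–Nagel (2000), §II.3.11). [cite: EngelNagel2000] -/
def generator (U : OneParameterGroup 𝕜 E) : E →ₗ.[𝕜] E :=
  C0Semigroup.generator U.toC0Semigroup

/-- Unfolding lemma: the generator of a group is the generator of its forward semigroup
(Engel–Nagel (2000), §II.3.11). [cite: EngelNagel2000] -/
theorem generator_eq (U : OneParameterGroup 𝕜 E) :
    U.generator = C0Semigroup.generator U.toC0Semigroup := rfl

end OneParameterGroup

end Semigroup

/-! ### Normed spaces: contractions, derivatives, density and closedness of the generator -/

section Normed

variable {𝕜 E : Type*} [RCLike 𝕜] [NormedAddCommGroup E] [NormedSpace 𝕜 E]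

namespace C0Semigroup

/-- A C₀-semigroup is a *contraction semigroup* if `‖T(t)‖ ≤ 1` for all `t ≥ 0`
(Engel–Nagel (2000), Ch. I Def. 5.6). [cite: EngelNagel2000] -/
def IsContraction (T : C0Semigroup 𝕜 E) : Prop := ∀ t : ℝ≥0, ‖T.app t‖ ≤ 1

/-- Orbits of `x ∈ D(A)` are right-differentiable at every `t ≥ 0` with right derivative
`T(t) A x`; this needs only continuity of `T(t)` and no completeness. Here `E` is also viewed as
a real normed space, compatibly with the `𝕜`-structure (`IsScalarTower ℝ 𝕜 E`)
(Engel–Nagel (2000), Ch. II Lemma 1.3 (ii), right-derivative half of the proof). [cite: EngelNagel2000] -/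
theorem hasDerivWithinAt_Ici_app_of_mem [NormedSpace ℝ E] [IsScalarTower ℝ 𝕜 E]
    (T : C0Semigroup 𝕜 E) (x : T.generator.domain) (t : ℝ≥0) :
    HasDerivWithinAt (fun s : ℝ => T.app s.toNNReal (x : E)) (T.app t (T.generator x))
      (Set.Ici (t : ℝ)) t := by
  rw [hasDerivWithinAt_iff_tendsto_slope, Set.Ici_sdiff_left]
  have hshift : Tendsto (fun s : ℝ => s - t) (𝓝[>] (t : ℝ)) (𝓝[>] 0) := by
    refine tendsto_nhdsWithin_of_tendsto_nhds_of_eventually_within _ ?_ ?_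
    · exact ((continuous_sub_right (t : ℝ)).tendsto' _ _ (sub_self _)).mono_left
        nhdsWithin_le_nhds
    · filter_upwards [self_mem_nhdsWithin] with s hs
      exact sub_pos.mpr (Set.mem_Ioi.mp hs)
  refine ((((T.app t).continuous.tendsto _).comp (T.tendsto_generator x)).comp hshift).congr' ?_
  filter_upwards [self_mem_nhdsWithin] with s (hs : (t : ℝ) < s)
  have hst : s.toNNReal = t + (s - t).toNNReal := by
    apply NNReal.coe_injective
    rw [NNReal.coe_add, Real.coe_toNNReal _ (le_trans t.2 hs.le),
      Real.coe_toNNReal _ (sub_nonneg.mpr hs.le)]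
    ring
  simp only [Function.comp_apply, slope, vsub_eq_sub, map_smul, map_sub, hst, app_add,
    Real.toNNReal_coe, mul_apply_eq_comp, RCLike.real_smul_eq_coe_smul (K := 𝕜)]

/-- Orbits of `x ∈ D(A)` are differentiable on `[0, ∞)` (two-sided for `t > 0`, from the right at
`t = 0`) with `d/dt T(t) x = T(t) A x`, for a C₀-semigroup on a Banach space `E` (left
differentiability uses local boundedness of `‖T(s)‖`, Engel–Nagel Prop. I.5.5, hence completeness).
Here `E` is also viewed as a real normed space, compatibly with the `𝕜`-structure
(`IsScalarTower ℝ 𝕜 E`) (Engel–Nagel (2000), Ch. II Lemma 1.3 (ii)). [cite: EngelNagel2000] -/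
def hasDerivWithinAt_app_of_mem : Prop :=
  ∀ [NormedSpace ℝ E] [IsScalarTower ℝ 𝕜 E] [CompleteSpace E] (T : C0Semigroup 𝕜 E) (x : T.generator.domain) (t : ℝ≥0),
    HasDerivWithinAt (fun s : ℝ => T.app s.toNNReal (x : E)) (T.app t (T.generator x))
      (Set.Ici 0) t

/-- The generator of a C₀-semigroup on a Banach space is densely defined
(Engel–Nagel (2000), Ch. II Thm. 1.4; Hille–Phillips (1957), Thm. 10.3.4). [cite: EngelNagel2000] -/
def dense_generator_domain : Prop :=
  ∀ [CompleteSpace E] (T : C0Semigroup 𝕜 E),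
    Dense (T.generator.domain : Set E)

/-- The generator of a C₀-semigroup on a Banach space is a closed operator
(Engel–Nagel (2000), Ch. II Thm. 1.4; Hille–Phillips (1957), Thm. 10.3.4). [cite: EngelNagel2000] -/
def isClosed_generator : Prop :=
  ∀ [CompleteSpace E] (T : C0Semigroup 𝕜 E),
    T.generator.IsClosed

end C0Semigroup

namespace OneParameterGroup

/-- For a strongly continuous group on a Banach space the one-sided (`t ↓ 0`) and two-sided
(`t → 0`, `t ≠ 0`) difference quotients `t⁻¹ (U(t) x - x)` converge for the same `x`, so
`x ∈ D(A)` iff the two-sided limit exists (Engel–Nagel (2000), §II.3.11, generator of a group and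
of its forward/backward semigroups). [cite: EngelNagel2000] -/
def mem_generator_domain_iff_two_sided : Prop :=
  ∀ [CompleteSpace E] (U : OneParameterGroup 𝕜 E) (x : E),
    x ∈ U.generator.domain ↔ ∃ y : E, Tendsto
      (fun t : ℝ => ((t⁻¹ : ℝ) : 𝕜) • (U.app t x - x)) (𝓝[≠] 0) (𝓝 y)

/-- For a strongly continuous group on a Banach space and `x ∈ D(A)`, the two-sided difference
quotient converges to `A x` (Engel–Nagel (2000), §II.3.11). [cite: EngelNagel2000] -/
def tendsto_generator_two_sided : Prop :=
  ∀ [CompleteSpace E] (U : OneParameterGroup 𝕜 E) (x : U.generator.domain),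
    Tendsto (fun t : ℝ => ((t⁻¹ : ℝ) : 𝕜) • (U.app t (x : E) - x)) (𝓝[≠] 0)
      (𝓝 (U.generator x))

end OneParameterGroup

end Normed

end Literature.Analysis.UnboundedOperators
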